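import Literature.Algebra.Homology.GroupCohomologyFiniteIndexFiniteness
import Literature.Algebra.Homology.InfiniteCyclicQuotientCohomology
import Mathlib.RingTheory.Noetherian.Basic
import Mathlib.RingTheory.Finiteness.Finsupp
import HarnessLib

/-!
# Finitely generated group cohomology: finite-index ascent and descent over a Noetherian ring

Topic `Algebra/Homology`; namespace `Literature.Algebra.Homology`.  Theorems only (no definition,
no named fact, no instance, no `sorry`).  Companion of `GroupCohomologyFiniteIndexFiniteness`
(FINITE coefficients) with FINITELY GENERATED coefficients over a Noetherian ring `k`
(`Module.Finite k`; for `k` a field: finite-dimensional representations and finite-dimensional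
cohomology) — the bookkeeping from "arithmetic groups are of type (WFL)"
([BorelSerre1973, Thm. 11.4.4]) to "`H^q(Γ, M)` est de type fini sur `ℤ` si `M` l'est"
([Serre1971CohomologieGroupesDiscrets, §1.8 Remarque]) and to the finite-dimensionality of
`H^q(Γ, V)` for arithmetic `Γ` ([Brown1982CohomologyGroups, VIII (5.1), VIII.4 Exercise 1]), to
be combined with `moduleFinite_groupCohomology_of_finiteType_resolution`
(`GroupCohomologyFiniteTypeResolution`), which turns a finite-type free resolution into finitely
generated cohomology:

* `coind_ext_of_forall_out`, `moduleFinite_coind_of_finiteIndex` — `Coind_S^G B` embeds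
  `k`-linearly into the finite product of copies of `B` over the right cosets of `S`,
  hence is finitely generated for `[G : S] < ∞`;
* `moduleFinite_of_exact`, `moduleFinite_groupCohomology_succ_of_shortExact` — exactness
  bookkeeping (Mathlib `Module.Finite.of_exact`, `groupCohomology.mapShortComplex₁_exact`); the
  start of the induction, `H⁰(G, A) = Aᴳ` finitely generated, is
  `moduleFinite_groupCohomology_zero` of `InfiniteCyclicQuotientCohomology` (imported);
* `moduleFinite_groupCohomology_of_finiteIndex` — **finite-index ascent** by dimension shifting
  along `0 → A → Coind_S^G Res_S A → Q → 0` and Shapiro's lemma (`groupCohomology.coindIso`);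
* `moduleFinite_groupCohomology_subgroup_of_finiteIndex` (descent),
  `moduleFinite_groupCohomology_of_mulEquiv` (transport along `G ≃* H`),
  `moduleFinite_groupCohomology_of_commensurable` — finite generation of `Hⁿ(-, M)` on finitely
  generated `M` is an invariant of the commensurability class.

## References

* K. S. Brown, *Cohomology of Groups*, GTM 87 (1982), III (6.2) Shapiro's lemma, VIII (5.1),
  VIII.4 Exercise 1 [Brown1982CohomologyGroups].
* J.-P. Serre, *Cohomologie des groupes discrets*, Ann. of Math. Studies 70 (1971), §1.8 Remarque
  [Serre1971CohomologieGroupesDiscrets].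
-/

noncomputable section

namespace Literature.Algebra.Homology

open CategoryTheory

universe u

variable {k G : Type u} [CommRing k] [Group G]

/-! ### Finitely generated coefficients over a Noetherian ring -/

section ModuleFinite

variable [IsNoetherianRing k]

omit [IsNoetherianRing k] in
/-- An element of `Coind_S^G B` (an `S`-equivariant function `G → B`) is determined by its values
on the chosen right-coset representatives `Quotient.out`. [folklore] -/
theorem coind_ext_of_forall_out (S : Subgroup G) (B : Rep k S) {f₁ f₂ : Rep.coind S.subtype B}
    (h : ∀ q : Quotient (QuotientGroup.rightRel S), f₁.1 q.out = f₂.1 q.out) : f₁ = f₂ := by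
  apply Subtype.ext
  funext g
  set q : Quotient (QuotientGroup.rightRel S) := Quotient.mk _ g with hq
  have hmem : g * q.out⁻¹ ∈ S := by
    have h' := Quotient.mk_out (s := QuotientGroup.rightRel S) g
    rw [QuotientGroup.rightRel_apply] at h'
    exact h'
  have hg : g = S.subtype ⟨g * q.out⁻¹, hmem⟩ * q.out := by simp
  rw [hg, (Representation.mem_coindV _ _ _).1 f₁.2, (Representation.mem_coindV _ _ _).1 f₂.2, h q]

/-- For `S ≤ G` of finite index and `B : Rep k S` finitely generated over the Noetherian ring `k`,
`Coind_S^G B` is finitely generated over `k`: it embeds `k`-linearly into the finite product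
the finite product of copies of `B` over the right cosets of `S`, by evaluation at
representatives. [folklore] -/
theorem moduleFinite_coind_of_finiteIndex (S : Subgroup G) [S.FiniteIndex] (B : Rep k S)
    [Module.Finite k B] : Module.Finite k (Rep.coind S.subtype B) := by
  haveI : Finite (Quotient (QuotientGroup.rightRel S)) :=
    Finite.of_equiv _ (QuotientGroup.quotientRightRelEquivQuotientLeftRel S).symm
  let φ : Rep.coind S.subtype B →ₗ[k] (Quotient (QuotientGroup.rightRel S) → B) :=
    { toFun := fun f q => f.1 q.out
      map_add' := fun _ _ => rfl
      map_smul' := fun _ _ => rfl }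
  exact Module.Finite.of_injective φ fun f₁ f₂ h =>
    coind_ext_of_forall_out S B fun q => congr_fun h q

/-- In an exact sequence `M₁ → M₂ → M₃` of modules over a Noetherian ring with `M₁` and `M₃`
finitely generated, `M₂` is finitely generated (`M₂` is an extension of the finitely generated
`range ⊆ M₃` by the image of `M₁`; Mathlib `Module.Finite.of_exact`). [folklore] -/
theorem moduleFinite_of_exact {X : ShortComplex (ModuleCat.{u} k)} (hX : X.Exact)
    (h₁ : Module.Finite k X.X₁) (h₃ : Module.Finite k X.X₃) : Module.Finite k X.X₂ := by
  haveI : Module.Finite k (LinearMap.range X.g.hom) :=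
    Module.Finite.of_injective (LinearMap.range X.g.hom).subtype Subtype.val_injective
  refine Module.Finite.of_exact (f := X.f.hom) (g := X.g.hom.rangeRestrict) (fun y => ?_)
    (LinearMap.surjective_rangeRestrict _)
  rw [Set.mem_range, ← LinearMap.mem_range, hX.moduleCat_range_eq_ker, LinearMap.mem_ker,
    Subtype.ext_iff]
  exact Iff.rfl

/-- One step of dimension shifting with finitely generated coefficients: for a short exact
`0 → X₁ → X₂ → X₃ → 0` in `Rep k G`, if `Hⁿ(G, X₃)` and `Hⁿ⁺¹(G, X₂)` are finitely generated then
so is `Hⁿ⁺¹(G, X₁)`. [cite: Brown1982CohomologyGroups, III (5.9) and (6.2)] -/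
theorem moduleFinite_groupCohomology_succ_of_shortExact {X : ShortComplex (Rep k G)}
    (hX : X.ShortExact) (n : ℕ) (h₃ : Module.Finite k (groupCohomology X.X₃ n))
    (h₂ : Module.Finite k (groupCohomology X.X₂ (n + 1))) :
    Module.Finite k (groupCohomology X.X₁ (n + 1)) :=
  moduleFinite_of_exact (groupCohomology.mapShortComplex₁_exact hX (rfl : n + 1 = n + 1)) h₃ h₂

/-- **Finite-index ascent with finitely generated coefficients.**  Let `k` be Noetherian and
`S ≤ G` of finite index such that `Hⁿ(S, B)` is finitely generated over `k` for every `B : Rep k S`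
finitely generated over `k` and every `n`.  Then `Hⁿ(G, A)` is finitely generated for every
`A : Rep k G` finitely generated over `k` and every `n` (for `k` a field: finite-dimensional).
Same dimension shifting as `finite_groupCohomology_of_finiteIndex`.
[cite: Brown1982CohomologyGroups, III (6.2) Shapiro's lemma; VIII (5.1)]
[cite: Serre1971CohomologieGroupesDiscrets, §1.8 Remarque] -/
theorem moduleFinite_groupCohomology_of_finiteIndex (S : Subgroup G) [S.FiniteIndex]
    (hS : ∀ (B : Rep k S), Module.Finite k B → ∀ n, Module.Finite k (groupCohomology B n))
    (n : ℕ) : ∀ (A : Rep k G), Module.Finite k A → Module.Finite k (groupCohomology A n) := by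
  induction n with
  | zero => intro A hA; exact moduleFinite_groupCohomology_zero A
  | succ n ih =>
    intro A hA
    -- the unit `A ⟶ Coind_S^G Res_S A`
    let B : Rep k G := Rep.coind S.subtype (Rep.res S.subtype A)
    let f : A ⟶ B := Rep.resCoindToHom S.subtype A (Rep.res S.subtype A) (𝟙 _)
    have hf : ∀ (a : A) (g : G), (f.hom a).1 g = A.ρ g a := fun a g => rfl
    have hfinj : Function.Injective f.hom := by
      intro a b h
      have h1 := congr_arg (fun x : B => x.1 1) h
      simpa only [hf, map_one, Module.End.one_apply] using h1
    -- its (G-stable) range and the quotient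
    let W : Submodule k B := LinearMap.range f.hom.toLinearMap
    have hW : ∀ g, W ≤ W.comap (B.ρ g) := by
      rintro g _ ⟨a, rfl⟩
      exact ⟨A.ρ g a, Rep.hom_comm_apply f g a⟩
    let X : ShortComplex (Rep k G) :=
      { X₁ := A
        X₂ := B
        X₃ := Rep.quotient B W hW
        f := f
        g := Rep.mkQ B W hW
        zero := by
          ext a
          exact (Submodule.Quotient.mk_eq_zero W).2 ⟨a, rfl⟩ }
    have hX : X.ShortExact :=
      { exact := (forget₂ (Rep k G) (ModuleCat k)).reflects_exact_of_faithful _ <|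
          (ShortComplex.moduleCat_exact_iff _).2 fun x hx => by
            obtain ⟨a, ha⟩ := (Submodule.Quotient.mk_eq_zero W).1 hx
            exact ⟨a, ha⟩
        mono_f := (Rep.mono_iff_injective _).2 hfinj
        epi_g := (Rep.epi_iff_surjective _).2 (Submodule.mkQ_surjective _) }
    -- finite generation of the terms
    haveI : Module.Finite k (Rep.res S.subtype A) := hA
    haveI hB : Module.Finite k B := moduleFinite_coind_of_finiteIndex S (Rep.res S.subtype A)
    haveI hQ : Module.Finite k (Rep.quotient B W hW) := inferInstanceAs (Module.Finite k (B ⧸ W))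
    have h₃ : Module.Finite k (groupCohomology X.X₃ n) := ih _ hQ
    have h₂ : Module.Finite k (groupCohomology X.X₂ (n + 1)) := by
      haveI := hS (Rep.res S.subtype A) hA (n + 1)
      exact Module.Finite.equiv
        (groupCohomology.coindIso (Rep.res S.subtype A) (n + 1)).toLinearEquiv.symm
    exact moduleFinite_groupCohomology_succ_of_shortExact hX n h₃ h₂

/-- **Finite-index descent with finitely generated coefficients** (Shapiro):
`Hⁿ(S, B) ≅ Hⁿ(G, Coind_S^G B)` with `Coind_S^G B` finitely generated.
[cite: Brown1982CohomologyGroups, III (6.2) Shapiro's lemma] -/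
theorem moduleFinite_groupCohomology_subgroup_of_finiteIndex (S : Subgroup G) [S.FiniteIndex]
    (hG : ∀ (A : Rep k G), Module.Finite k A → ∀ n, Module.Finite k (groupCohomology A n))
    (B : Rep k S) [Module.Finite k B] (n : ℕ) : Module.Finite k (groupCohomology B n) := by
  haveI := hG (Rep.coind S.subtype B) (moduleFinite_coind_of_finiteIndex S B) n
  exact Module.Finite.equiv (groupCohomology.coindIso B n).toLinearEquiv

omit [IsNoetherianRing k] in
/-- Transport along `e : G ≃* H` with finitely generated coefficients
(`Hⁿ(G, Res_e A) ≅ Hⁿ(H, A)`, Mathlib `groupCohomology.mapIso`). [folklore] -/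
theorem moduleFinite_groupCohomology_of_mulEquiv {H : Type u} [Group H] (e : G ≃* H)
    (hG : ∀ (B : Rep k G), Module.Finite k B → ∀ n, Module.Finite k (groupCohomology B n))
    (A : Rep k H) [Module.Finite k A] (n : ℕ) : Module.Finite k (groupCohomology A n) := by
  haveI := hG (Rep.res (e : G →* H) A) ‹Module.Finite k A› n
  exact Module.Finite.equiv (groupCohomology.mapIso (A := A) (B := Rep.res (e : G →* H) A) e
    (LinearEquiv.refl k _) (fun _ => rfl) n).toLinearEquiv

/-- **Commensurable subgroups, finitely generated coefficients**: if `Γ₀, Γ ≤ G` are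
commensurable and `Hⁿ(Γ₀, -)` is finitely generated on finitely generated coefficients, so is
`Hⁿ(Γ, -)` (descent to `Γ ∩ Γ₀`, transport, ascent). [cite: Serre1971CohomologieGroupesDiscrets,
§1.8] [cite: Brown1982CohomologyGroups, VIII (5.1)] -/
theorem moduleFinite_groupCohomology_of_commensurable (Γ₀ Γ : Subgroup G)
    [(Γ.subgroupOf Γ₀).FiniteIndex] [(Γ₀.subgroupOf Γ).FiniteIndex]
    (h₀ : ∀ (B : Rep k Γ₀), Module.Finite k B → ∀ n, Module.Finite k (groupCohomology B n))
    (A : Rep k Γ) [Module.Finite k A] (n : ℕ) : Module.Finite k (groupCohomology A n) := by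
  haveI : ((Γ ⊓ Γ₀).subgroupOf Γ₀).FiniteIndex := by
    rw [Subgroup.inf_subgroupOf_right]
    infer_instance
  haveI : ((Γ ⊓ Γ₀).subgroupOf Γ).FiniteIndex := by
    rw [Subgroup.inf_subgroupOf_left]
    infer_instance
  have h₁ : ∀ (B : Rep k ((Γ ⊓ Γ₀).subgroupOf Γ₀)), Module.Finite k B → ∀ m,
      Module.Finite k (groupCohomology B m) :=
    fun B hB m => by
      haveI := hB
      exact moduleFinite_groupCohomology_subgroup_of_finiteIndex _ h₀ B m
  have e : (Γ ⊓ Γ₀).subgroupOf Γ₀ ≃* (Γ ⊓ Γ₀).subgroupOf Γ :=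
    (Subgroup.subgroupOfEquivOfLe inf_le_right).trans
      (Subgroup.subgroupOfEquivOfLe inf_le_left).symm
  have h₂ : ∀ (B : Rep k ((Γ ⊓ Γ₀).subgroupOf Γ)), Module.Finite k B → ∀ m,
      Module.Finite k (groupCohomology B m) :=
    fun B hB m => by
      haveI := hB
      exact moduleFinite_groupCohomology_of_mulEquiv e h₁ B m
  exact moduleFinite_groupCohomology_of_finiteIndex _ h₂ n A ‹Module.Finite k A›

end ModuleFinite

end Literature.Algebra.Homology
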